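import Summits.BirchSwinnertonDyer.BirchSwinnertonDyer.Theorems.BiquadraticEisensteinDescentEisensteinHeartFlatCMInertBadKPrimeKatzLineFromFlat
import Summits.BirchSwinnertonDyer.BirchSwinnertonDyer.Theorems.InertBadSignedBranchesInertBadAtThreeHeartTiedFrameData
import Summits.BirchSwinnertonDyer.BirchSwinnertonDyer.Theorems.InertBadSignedBranchesInertBadAtThreeHeartSqrtEndomorphism
import Summits.BirchSwinnertonDyer.BirchSwinnertonDyer.Theorems.InertBadSignedBranchesInertBadAtThreeHeartOfHeartFlat
import HarnessLib

set_option linter.dupNamespace false -- `Summit.BirchSwinnertonDyer.BirchSwinnertonDyer.Theorems.…` (summit = sub, D-0017)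
set_option autoImplicit false

/-!
# Crux `InertBadAtThree` (stmt-BirchSwinnertonDyer-19225), line `rubin_e1_inert_three` — the ♭-HEART AT `p = 3` FROM THE RANGE FORM
# V4R@3 OF THE INPUT ALONE: no Katz–Hida–Tilouine measure, no Hsieh Theorem A, no tied Katz line frame (V2@3) — the `p = 3` twin of the
# lead's `…EisensteinHeartFlatCMInertBadKPrimeKatzLineFromFlat.eisensteinHeartFlatCMInertBadKPrime_of_V4R` (crux 21341, road (B′))

Routes `InertBadSignedBranches` / `BiquadraticEisensteinDescent` (cell `pub/bsd-wall`, width seat `bsd-wall-cm-bed-w1` g20). THEOREMS ONLY;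
supports, does not close, stmt-BirchSwinnertonDyer-19225.

The `p = 3` composition of record (skeleton v8, `Cruxes/InertBadAtThree/Lines/rubin_e1_inert_three.lean`) obtains the ♭-heart at `3`
(`HeartFlatAtThree`) from Hsieh's Theorem A, a TIED KATZ LINE FRAME V2@3 — i.e. the named fact `hsieh2014mu_prop49_exists_isMeasure`
(Katz 1978 (5.3.0) / Hida–Tilouine 1993 Thm II in Hsieh's normalisation, conjunct 19 of `PrintedInputsAtThreeMin`) plus Deuring's
theorem (conjunct 20) — and the research input V4K@3 (`…HeartFlatOfParts.heartFlatAtThree_of_parts`, p636175; `…HeartStubV2OfKatz`).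
The lead of crux 21341 (seat `bsd-wall-cm-bed-p1` g7) observed at `p ≥ 5` that on Hsieh's range the crux's OWN ♭-frame `Q` takes the
Katz-normalised values for one choice of the constants `(C_K, Ω, Ω′_p)` (`…KatzLineFromFlat.exists_constants_rangeFrame`, typed at
every odd `p`), so that the crux follows from the RANGE FORM `V4R` of the input alone. This file runs that argument at `p = 3`:

* `heartFlatAtThree_of_V4R` — **♭-heart@3 ⟸ V4R@3 ALONE**. `V4R@3` is the registered research stub `stub_katzLineDivisibilityAtThree`
  (V4K@3, the `p = 3` text of BED's `stub_V4K`) with its ONE frame binder `KatzCM.IsBaseChangeLine ι′ Σ_p S T κ γ λ ϑ C_K Ω Ω′_p G`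
  replaced by the values of `G` on Hsieh's range — LITERALLY the lead's `hV4R` text with `5 ≤ p` ↦ `p = 3`. Proof = the lead's §3:
  the `[√d₀]` datum at `3` (`…HeartSqrtEndomorphism.sqrtEndomorphism_three`, p635498), `U = Stab(√d₀)`, the CM-datum adapter
  (`…CMDatumAdapter.heartShape_xac_of_sqrt_endomorphism`, `p ≠ 2`), the UNCONDITIONAL tied frame data at an odd prime
  (`…InertBadAtThreeHeartTiedFrameData.exists_tiedFrameData_of_ne_two` = the lead's `exists_tiedFrameData` with `5 ≤ p` ↦ `p ≠ 2`),
  the constants of `exists_constants_rangeFrame` making `Q` an admissible `G`, and `V4R@3` at `G := Q`.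
* `heartAtThree_of_V4R` — **E_K′@3 (`HeartAtThree`) ⟸ V4R@3** by `…HeartOfHeartFlat.heartAtThree_of_heartFlatAtThree` (p635870; (B) =
  Hsieh's Thm B is `HeartAtThree`'s own antecedent).

Consequence for the line: `PrintedInputsAtThreeMin` can drop conjuncts 19 (`hsieh2014mu_prop49_exists_isMeasure`) and 20
(`Deuring_exists_heckeCharacter_of_maximalCM`, a kernel theorem anyway, p698052): the `p = 3` residual of crux 19225 = eighteen named print
facts + V4R@3 (sequel `…InertBadAtThreeOfV4R`: the composition). HONEST STATUS: V4R@3 implies V4K@3 outright and is equivalent to it granted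
the Katz measure; both are the SAME research statement (NOT in print on the `p`-ramified niveau-2 branch; rider R1 at `p = 3`: Hsieh JAMS
L.7.15 / P.7.16 use `p > 3`). CONDITIONAL on V4R@3 only. Nothing about any case of BSD is asserted; 19225 stays OPEN.

References: [Hsieh2014mu] Prop. 4.9 (§4.8), §4.7; [Castella2018] Thm. 3.1; [Hsieh2014JAMS] Thm. 8.14; [Washington1997] §13.1; [Brink2007] Cor. 1.
-/

noncomputable section

open scoped Classical NumberField
open NumberField IsDedekindDomain Field PowerSeries Finset
open WeierstrassCurve
open Literature.NumberTheory.EllipticCurves Literature.NumberTheory.GaloisRepresentations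
open Literature.NumberTheory.EllipticCurves.ModularForms Literature.NumberTheory.EllipticCurves.Rank1Residual
  Literature.NumberTheory.EllipticCurves.Hsieh2014 Literature.NumberTheory.EllipticCurves.GreenbergSelmer
  Literature.NumberTheory.EllipticCurves.Module Literature.NumberTheory.EllipticCurves.IwasawaDual
  Summit.BirchSwinnertonDyer.Rank1Residual Summit.BirchSwinnertonDyer.Rank1Residual.X11b
  Summit.BirchSwinnertonDyer.Rank1Residual.X11b.AcSelmer
  Summit.BirchSwinnertonDyer.BirchSwinnertonDyer.Theorems.BiquadraticEisensteinDescentDefs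
  Summit.BirchSwinnertonDyer.BirchSwinnertonDyer.Theorems.BiquadraticEisensteinDescentEisensteinHeartFlatCMInertBadKPrimeSelmerTower
  Summit.BirchSwinnertonDyer.BirchSwinnertonDyer.Theorems.BiquadraticEisensteinDescentEisensteinHeartFlatCMInertBadKPrimeShapiroDatum
  Summit.BirchSwinnertonDyer.BirchSwinnertonDyer.Theorems.BiquadraticEisensteinDescentEisensteinHeartFlatCMInertBadKPrimeCMDatumAdapter

namespace Summit.BirchSwinnertonDyer.BirchSwinnertonDyer.Theorems.InertBadSignedBranchesInertBadAtThreeHeartOfV4R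

open Summit.BirchSwinnertonDyer.BirchSwinnertonDyer.Theorems.BiquadraticEisensteinDescentEisensteinHeartFlatCMInertBadKPrimeKatzLineFromFlat
  (exists_constants_rangeFrame)
open Summit.BirchSwinnertonDyer.BirchSwinnertonDyer.Theorems.InertBadSignedBranchesInertBadAtThreeHeartTiedFrameData
  (exists_tiedFrameData_of_ne_two)
open Summit.BirchSwinnertonDyer.BirchSwinnertonDyer.Theorems.InertBadSignedBranchesInertBadAtThreeHeartSqrtEndomorphism
  (sqrtEndomorphism_three)
open Summit.BirchSwinnertonDyer.BirchSwinnertonDyer.Theorems.BiquadraticEisensteinDescentEisensteinHeartFlatCMInertBadKPrimeCMDatumAdapter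
  (normal_of_forall_mem_iff heartShape_xac_of_sqrt_endomorphism)

/-! ### §1 The ♭-heart at `p = 3` from V4R@3 alone -/

/-- **♭-heart@3 ⟸ V4R@3 ALONE — no Katz–Hida–Tilouine measure, no Hsieh Theorem A, no V2@3, no Deuring hypothesis.** `V4R@3` is the
registered research stub V4K@3 (`stub_katzLineDivisibilityAtThree` of line `rubin_e1_inert_three`, = BED's `stub_V4K` text at `p = 3`)
with its ONE frame binder `KatzCM.IsBaseChangeLine ι′ Σ_p S T κ γ λ ϑ C_K Ω Ω′_p G` replaced by the values of `G` on Hsieh's range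
(`G(r(γ) − 1) = ι′⁻¹(interpolationValue ι′ Σ_p S T λ (χ∘N) 1 κ_n ϑ C_K Ω (L(λ·χ∘N, 0)))·∏_w Ω′_{p,w}^{1+2κ_n(w)}` for every
everywhere-unramified `χ` of type `(n, −n)`, `n ≥ 1`, with avatar `r` through `κ`) — the lead's `hV4R` with `5 ≤ p` ↦ `p = 3`.
Conclusion = the line's `HeartFlatAtThree` (BED's crux text `EisensteinHeartFlatCMInertBadKPrime` at `p = 3`). Proof: the `[√d₀]` datum
at `3` and `U = Stab(√d₀)`, the CM-datum adapter (Shapiro, `p`-part; `3 ≠ 2`), the UNCONDITIONAL tied frame data at the odd prime `3`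
(`L = K′(√d_CM)`, `Σ_p = {𝔓′}`, `S`, `T`, `λ`, `ϑ`, `w₁ ≠ w₂`, (T), (C), (L), (R)), the constants of `exists_constants_rangeFrame` making
the crux's own `Q` an admissible `G` (`a_3(f) = 0`, `3 ∣ N`), and V4R@3 at `G := Q`. [cite: Hsieh2014mu, Prop. 4.9 (§4.8)]
[cite: Castella2018, Thm. 3.1 (arXiv:1704.06608 p. 9)] [cite: Hsieh2014JAMS, Thm. 8.14] [cite: Brink2007, Cor. 1 (p. 2136)] -/
theorem heartFlatAtThree_of_V4R
    (hV4R3 : ∀ (W : WeierstrassCurve ℚ) [W.IsElliptic] [W.IsGloballyMinimal] (p : ℕ) [Fact p.Prime]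
        [NeZero (W.conductorNorm ℤ)] (K : Type) [Field K] [NumberField K],
        W.HasCM → p = 3 → CMInert W p → ¬ Good W p →
        IsImaginaryQuadratic K → SatisfiesHeegnerHypothesis (W.conductorNorm ℤ) K →
        4 < (NumberField.discr K).natAbs → ¬ p ∣ NumberField.classNumber K →
        ∀ (κ : ZpExtension K p), κ.IsAnticyclotomic →
          ∀ (γ : Field.absoluteGaloisGroup K) [Fact (κ.IsTopGenerator γ)]
            (𝔭 : HeightOneSpectrum (𝓞 K)), ((p : ℕ) : 𝓞 K) ∈ 𝔭.asIdeal →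
            𝔭.asIdeal.ramificationIdx (𝓞 ℚ) = 1 → 𝔭.asIdeal.inertiaDeg (𝓞 ℚ) = 1 →
            ∀ (f : CuspForm (CongruenceSubgroup.Gamma0 (W.conductorNorm ℤ)) 2), IsNewformOf W f →
              ∀ (ι' : PadicAlgCl p ≃+* ℂ),
                (∀ (w : InfinitePlace K) (k : 𝓞 K), k ∈ 𝔭.asIdeal ↔ ‖ι'.symm (w.embedding (k : K))‖ < 1) →
                    ∀ (𝔭' : HeightOneSpectrum (𝓞 K)), ((p : ℕ) : 𝓞 K) ∈ 𝔭'.asIdeal → 𝔭' ≠ 𝔭 →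
                    Module.IsTorsion (IwasawaAlgebra p) (XAc (W.baseChange K) p κ 𝔭' ∅ γ) →
                    ∀ (L : Type) [Field L] [NumberField L] [Algebra K L] [IsGalois K L]
                      (Sp S T : Finset (HeightOneSpectrum (𝓞 L))) (lam : HeckeCharacter L) (ϑ : L) (CK : ℂ)
                      (Ω : InfinitePlace L → ℂ) (ΩpK : InfinitePlace L → ℂ_[p]) (G : PowerSeries 𝓞_ℂ_[p])
                      (w₁ w₂ : InfinitePlace L) (cL cL' : ℂ),
                      w₁ ≠ w₂ → (∀ w : InfinitePlace L, w = w₁ ∨ w = w₂) →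
                      (∀ (χ : HeckeCharacter K) (n : ℕ), 0 < n → (∀ v : HeightOneSpectrum (𝓞 K), χ.IsUnramifiedAt v) →
                        χ.HasInfinityType (fun _ ↦ (n : ℤ)) (fun _ ↦ -(n : ℤ)) →
                        KatzCM.HasKatzType ι' Sp (lam * χ.compRelNorm L) 1 (fun w ↦ if w = w₁ then n else n - 1)) →
                      (∀ (χ : HeckeCharacter K) (n : ℕ), 0 < n → (∀ v : HeightOneSpectrum (𝓞 K), χ.IsUnramifiedAt v) →
                        χ.HasInfinityType (fun _ ↦ (n : ℤ)) (fun _ ↦ -(n : ℤ)) →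
                        LFunction.HasEntireContinuation (heckeLFunction (lam * χ.compRelNorm L))) →
                      cL ≠ 0 → cL' ≠ 0 →
                      (∀ (χ : HeckeCharacter K) (n : ℕ), 0 < n → (∀ v : HeightOneSpectrum (𝓞 K), χ.IsUnramifiedAt v) →
                        χ.HasInfinityType (fun _ ↦ (n : ℤ)) (fun _ ↦ -(n : ℤ)) →
                        ∀ hL : LFunction.HasEntireContinuation (heckeLFunction (lam * χ.compRelNorm L)),
                          hL.continuation 0 = cL * cL' ^ n * rankinSelbergValueHecke f χ 1) →
                      (∀ w ∈ S ∪ KatzCM.primesOver L p, ¬ lam.IsUnramifiedAt w) →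
                      (∀ w ∈ Sp ∪ T, ¬ lam.IsUnramifiedAt w) →
                      CK ≠ 0 → (∀ w, Ω w ≠ 0) → (∀ w, (KatzCM.embeddingAt ι' Sp w ϑ).im ≠ 0) → (∀ w, ΩpK w ≠ 0) →
                      (∀ (χ : HeckeCharacter K) (n : ℕ), 0 < n → (∀ v : HeightOneSpectrum (𝓞 K), χ.IsUnramifiedAt v) →
                        χ.HasInfinityType (fun _ ↦ (n : ℤ)) (fun _ ↦ -(n : ℤ)) →
                        ∀ r : FramedGaloisRep K (PadicAlgCl p) 1, IsPAdicAvatarOf ι' χ r → FactorsThroughZp κ r →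
                        ∀ hL : LFunction.HasEntireContinuation (heckeLFunction (lam * χ.compRelNorm L)),
                          IntSeries.HasValueAt G (avatarValueAt r γ - 1)
                            ((((ι'.symm (KatzCM.interpolationValue ι' Sp S T lam (χ.compRelNorm L) 1
                                (fun w ↦ if w = w₁ then n else n - 1) ϑ CK Ω (hL.continuation 0))) : PadicAlgCl p) : ℂ_[p]) *
                              ∏ w, ΩpK w ^ (1 + 2 * (fun w ↦ if w = w₁ then n else n - 1) w))) →
                    ∀ (d₀ : ℤ) (r : AlgebraicClosure K) (ψ : (W.baseChange K).geomPoints →+ (W.baseChange K).geomPoints),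
                      r * r = algebraMap K (AlgebraicClosure K) (d₀ : K) →
                      r ∉ Set.range (algebraMap K (AlgebraicClosure K)) →
                      (∀ y : ZMod p, y * y ≠ PadicInt.toZMod ((d₀ : ℤ) : ℤ_[p])) →
                      (∀ σ : absoluteGaloisGroup K, σ • r = r → ∀ P : (W.baseChange K).geomPoints, σ • ψ P = ψ (σ • P)) →
                      (∀ σ : absoluteGaloisGroup K, σ • r = -r → ∀ P : (W.baseChange K).geomPoints, σ • ψ P = -ψ (σ • P)) →
                      (∀ P, ψ (ψ P) = d₀ • P) →
                    ∀ (U : Subgroup (absoluteGaloisGroup K)) [U.Normal], (∀ σ, σ ∈ U ↔ σ • r = r) →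
                    ∀ (φ : (W.baseChange K).geomPrimaryTorsion p →+ (W.baseChange K).geomPrimaryTorsion p)
                      (_ : ∀ m, ((φ m : (W.baseChange K).geomPrimaryTorsion p) : (W.baseChange K).geomPoints) = ψ m)
                      (hφH' : ∀ (x : (κ.kerSubgroup ⊓ U : Subgroup (absoluteGaloisGroup K)))
                        (m : (W.baseChange K).geomPrimaryTorsion p), φ (x • m) = x • φ m)
                      (hφU : ∀ σ ∈ U, ∀ m : (W.baseChange K).geomPrimaryTorsion p, φ (σ • m) = σ • φ m)
                      (hφU' : ∀ σ, σ ∉ U → ∀ m : (W.baseChange K).geomPrimaryTorsion p, φ (σ • m) = -(σ • φ m))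
                      (hφ2 : ∀ m, φ (φ m) = d₀ • m)
                      (γ' : absoluteGaloisGroup K) (_ : κ.IsTopGenerator γ') (_ : γ' ∈ U)
                      (f₁ : AddMonoid.End (selmerOver (κ.kerSubgroup ⊓ U) ((W.baseChange K).geomPrimaryTorsion p) p 𝔭' ∅))
                      (_hf : ∀ s, ((f₁ s : selmerOver (κ.kerSubgroup ⊓ U) ((W.baseChange K).geomPrimaryTorsion p) p 𝔭' ∅) :
                        subgroupH1 (κ.kerSubgroup ⊓ U) ((W.baseChange K).geomPrimaryTorsion p)) =
                          conjH1 (κ.kerSubgroup ⊓ U) ((W.baseChange K).geomPrimaryTorsion p) γ' s)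
                      (h : IsLocNil p (f₁ - 1))
                      (δ : LocNilDual (selmerOver (κ.kerSubgroup ⊓ U) ((W.baseChange K).geomPrimaryTorsion p) p 𝔭' ∅) f₁ h
                        →ₗ[IwasawaAlgebra p]
                        LocNilDual (selmerOver (κ.kerSubgroup ⊓ U) ((W.baseChange K).geomPrimaryTorsion p) p 𝔭' ∅) f₁ h)
                      (hδ : ∀ (x : LocNilDual (selmerOver (κ.kerSubgroup ⊓ U) ((W.baseChange K).geomPrimaryTorsion p) p 𝔭' ∅) f₁ h)
                        (s t : selmerOver (κ.kerSubgroup ⊓ U) ((W.baseChange K).geomPrimaryTorsion p) p 𝔭' ∅),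
                        (t : subgroupH1 (κ.kerSubgroup ⊓ U) ((W.baseChange K).geomPrimaryTorsion p)) =
                          resH1Hom (ContinuousMonoidHom.id _) φ hφH'
                            (s : subgroupH1 (κ.kerSubgroup ⊓ U) ((W.baseChange K).geomPrimaryTorsion p)) → δ x s = x t)
                      (b : Module.Basis (Fin 2) ℤ_[p]
                        (AdjoinRoot (Polynomial.X ^ 2 - Polynomial.C ((d₀ : ℤ) : ℤ_[p]) : Polynomial ℤ_[p]))) (hb0 : b 0 = 1)
                      (hb1 : b 1 * b 1 = algebraMap ℤ_[p]
                        (AdjoinRoot (Polynomial.X ^ 2 - Polynomial.C ((d₀ : ℤ) : ℤ_[p]) : Polynomial ℤ_[p])) ((d₀ : ℤ) : ℤ_[p]))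
                      (ι : AdjoinRoot (Polynomial.X ^ 2 - Polynomial.C ((d₀ : ℤ) : ℤ_[p]) : Polynomial ℤ_[p]) →+* 𝓞_ℂ_[p])
                      (_ : ι.comp (algebraMap ℤ_[p] _) = R1.toCpInt p),
                      ∃ m : ℕ, ∀ x ∈ (charIdeal (PowerSeries
                          (AdjoinRoot (Polynomial.X ^ 2 - Polynomial.C ((d₀ : ℤ) : ℤ_[p]) : Polynomial ℤ_[p])))
                          (WithQuadratic (LocNilDual (selmerOver (κ.kerSubgroup ⊓ U) ((W.baseChange K).geomPrimaryTorsion p)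
                            p 𝔭' ∅) f₁ h) b hb0 hb1 δ
                            (delta_sq (W.baseChange K) κ 𝔭' ∅ U φ hφH' hφU hφU' d₀ hφ2 f₁ h δ hδ))).map (PowerSeries.map ι),
                        (PowerSeries.C ((p : ℕ) : 𝓞_ℂ_[p]) : PowerSeries 𝓞_ℂ_[p]) ^ m * x ∈ Ideal.span {G}) :
    ∀ (W : WeierstrassCurve ℚ) [W.IsElliptic] [W.IsGloballyMinimal] (p : ℕ) [Fact p.Prime]
      [NeZero (W.conductorNorm ℤ)] (K : Type) [Field K] [NumberField K],
      W.HasCM → W.analyticRank = 1 → p = 3 → CMInert W p → ¬ Good W p →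
      IsImaginaryQuadratic K → SatisfiesHeegnerHypothesis (W.conductorNorm ℤ) K →
      4 < (NumberField.discr K).natAbs →
      ¬ p ∣ NumberField.classNumber K →
      (W.quadraticTwist (NumberField.discr K : ℚ)).entireLFunction 1 ≠ 0 →
      ∀ (κ : ZpExtension K p), κ.IsAnticyclotomic →
        ∀ (γ : Field.absoluteGaloisGroup K) [Fact (κ.IsTopGenerator γ)]
          (𝔭 : HeightOneSpectrum (𝓞 K)), ((p : ℕ) : 𝓞 K) ∈ 𝔭.asIdeal →
          𝔭.asIdeal.ramificationIdx (𝓞 ℚ) = 1 → 𝔭.asIdeal.inertiaDeg (𝓞 ℚ) = 1 →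
          ∀ (f : CuspForm (CongruenceSubgroup.Gamma0 (W.conductorNorm ℤ)) 2), IsNewformOf W f →
            ∀ (ι' : PadicAlgCl p ≃+* ℂ),
              (∀ (w : InfinitePlace K) (k : 𝓞 K), k ∈ 𝔭.asIdeal ↔ ‖ι'.symm (w.embedding (k : K))‖ < 1) →
              ∀ (ΩK : ℂ) (Ωp : (unrIntegers p)ˣ) (Q : PowerSeries (PadicComplexInt p)), ΩK ≠ 0 →
                R1.IsBDPLFunctionInt p ι' 𝔭 κ γ f ΩK ((Ωp : unrIntegers p) : (PadicComplex p)) Q →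
                  ∀ (𝔭' : HeightOneSpectrum (𝓞 K)), ((p : ℕ) : 𝓞 K) ∈ 𝔭'.asIdeal → 𝔭' ≠ 𝔭 →
                  Module.IsTorsion (IwasawaAlgebra p) (XAc (W.baseChange K) p κ 𝔭' ∅ γ) →
                  ∃ m : ℕ, ∀ x ∈ (XAc.charIdeal (W.baseChange K) p κ 𝔭' ∅ γ).map (PowerSeries.map (R1.toCpInt p)),
                    (PowerSeries.C ((p : ℕ) : PadicComplexInt p) : PowerSeries (PadicComplexInt p)) ^ m * x ∈
                      Ideal.span {Q} := by
  intro W _ _ p _ _ K _ _ hCM _hr hp3 hin hbad hK hHN hd4 hh _hLt κ hκ γ _ 𝔭 h𝔭 he hf1 f hf ι' hι ΩK Ωp Q hΩK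
    hQ 𝔭' h𝔭' hne htors
  have hp : p.Prime := Fact.out
  have hp2 : p ≠ 2 := by omega
  have hpN : p ∣ W.conductorNorm ℤ := (W.dvd_conductorNorm_iff_not_hasGoodReductionAtPrime p).mpr hbad
  -- the CM endomorphism `[√d₀]` over `K′` at `p = 3` (p635498) and the index-two subgroup `U = Γ_L`
  obtain ⟨d₀, r, ψ, hr, hrK, hd, hψU, hψU', hψ2⟩ := sqrtEndomorphism_three W p K hCM hp3 hin hbad hK hHN 𝔭 𝔭' h𝔭 h𝔭' hne
  let U : Subgroup (absoluteGaloisGroup K) := MulAction.stabilizer (absoluteGaloisGroup K) r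
  have hUr : ∀ σ, σ ∈ U ↔ σ • r = r := fun σ ↦ MulAction.mem_stabilizer_iff
  haveI : U.Normal := normal_of_forall_mem_iff r (d₀ : K) hr hrK U hUr
  haveI : (W.baseChange K).IsElliptic := inferInstanceAs (W.map (algebraMap ℚ K)).IsElliptic
  haveI : Module.Finite (IwasawaAlgebra p) (XAc (W.baseChange K) p κ 𝔭' ∅ γ) := XAc.module_finite_empty κ 𝔭' γ
  have hΩp : ((Ωp : unrIntegers p) : ℂ_[p]) ≠ 0 := by
    rw [Ne, ZeroMemClass.coe_eq_zero]
    exact Ωp.ne_zero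
  have hap : cuspCoeff f p = 0 :=
    Summit.BirchSwinnertonDyer.BirchSwinnertonDyer.Theorems.BiquadraticEisensteinDescentEisensteinHeartFlatCMInertBadKPrimeCuspCoeffVanishing.cuspCoeff_eq_zero_of_hasCM_of_not_good
      hCM hbad hf
  refine heartShape_xac_of_sqrt_endomorphism (W.baseChange K) κ 𝔭' ∅ U hp2 γ ψ d₀ r hr hrK hUr hψU hψU' hψ2 hd htors ?_
  intro φ hφψ hφH' hφU hφU' hφ2 γ' hγ' hγ'U f₁ hf₁ h δ hδ b hb0 hb1 ιO hιO
  -- the tied frame data at the odd prime `3` (unconditional) and the constants making `Q` an admissible Katz line series on the range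
  obtain ⟨L, _, _, _, _, Sp, S, T, lam, ϑ, w₁, w₂, cL, cL', hw, huniv, hT, hcont, hcL, hcL', hLval, hramS, hramT, hIm⟩ :=
    exists_tiedFrameData_of_ne_two W p K hCM hp2 hin hbad hK hHN hd4 hh κ hκ γ 𝔭 h𝔭 he hf1 f hf ι' hι 𝔭' h𝔭' hne
  obtain ⟨CK, Ω, ΩpK, hCK, hΩ, hΩpK, hGQ⟩ :=
    exists_constants_rangeFrame hK hp2 κ hκ hh hw huniv hcL hcL' hLval hpN hap hramS hramT hIm hΩK hΩp hQ
  -- THE INPUT (range form) at `G := Q`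
  exact hV4R3 W p K hCM hp3 hin hbad hK hHN hd4 hh κ hκ γ 𝔭 h𝔭 he hf1 f hf ι' hι 𝔭' h𝔭' hne htors
    L Sp S T lam ϑ CK Ω ΩpK Q w₁ w₂ cL cL' hw huniv hT hcont hcL hcL' hLval hramS hramT hCK hΩ hIm hΩpK hGQ
    d₀ r ψ hr hrK hd hψU hψU' hψ2 U hUr φ hφψ hφH' hφU hφU' hφ2 γ' hγ' hγ'U f₁ hf₁ h δ hδ b hb0 hb1 ιO hιO

/-! ### §2 E_K′@3 from V4R@3 -/

/-- **E_K′@3 (`HeartAtThree` of line `rubin_e1_inert_three`) ⟸ V4R@3**: §1 composed with `…HeartOfHeartFlat.heartAtThree_of_heartFlatAtThree`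
(p635870: granted Hsieh's Thm B — `HeartAtThree`'s own antecedent —, the ♭-heart at `3` gives `char(X_ac^{𝔭′})(0) ∣ Q(0)`). So the
`p = 3` heart needs NEITHER the Katz measure NOR a tied Katz line frame. [cite: Hsieh2014, Thm. B p. 712 (Doc. Math. 19)]
[cite: Hsieh2014mu, Prop. 4.9 (§4.8)] [cite: Hsieh2014JAMS, Thm. 8.14] -/
theorem heartAtThree_of_V4R
    (hV4R3 : ∀ (W : WeierstrassCurve ℚ) [W.IsElliptic] [W.IsGloballyMinimal] (p : ℕ) [Fact p.Prime]
        [NeZero (W.conductorNorm ℤ)] (K : Type) [Field K] [NumberField K],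
        W.HasCM → p = 3 → CMInert W p → ¬ Good W p →
        IsImaginaryQuadratic K → SatisfiesHeegnerHypothesis (W.conductorNorm ℤ) K →
        4 < (NumberField.discr K).natAbs → ¬ p ∣ NumberField.classNumber K →
        ∀ (κ : ZpExtension K p), κ.IsAnticyclotomic →
          ∀ (γ : Field.absoluteGaloisGroup K) [Fact (κ.IsTopGenerator γ)]
            (𝔭 : HeightOneSpectrum (𝓞 K)), ((p : ℕ) : 𝓞 K) ∈ 𝔭.asIdeal →
            𝔭.asIdeal.ramificationIdx (𝓞 ℚ) = 1 → 𝔭.asIdeal.inertiaDeg (𝓞 ℚ) = 1 →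
            ∀ (f : CuspForm (CongruenceSubgroup.Gamma0 (W.conductorNorm ℤ)) 2), IsNewformOf W f →
              ∀ (ι' : PadicAlgCl p ≃+* ℂ),
                (∀ (w : InfinitePlace K) (k : 𝓞 K), k ∈ 𝔭.asIdeal ↔ ‖ι'.symm (w.embedding (k : K))‖ < 1) →
                    ∀ (𝔭' : HeightOneSpectrum (𝓞 K)), ((p : ℕ) : 𝓞 K) ∈ 𝔭'.asIdeal → 𝔭' ≠ 𝔭 →
                    Module.IsTorsion (IwasawaAlgebra p) (XAc (W.baseChange K) p κ 𝔭' ∅ γ) →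
                    ∀ (L : Type) [Field L] [NumberField L] [Algebra K L] [IsGalois K L]
                      (Sp S T : Finset (HeightOneSpectrum (𝓞 L))) (lam : HeckeCharacter L) (ϑ : L) (CK : ℂ)
                      (Ω : InfinitePlace L → ℂ) (ΩpK : InfinitePlace L → ℂ_[p]) (G : PowerSeries 𝓞_ℂ_[p])
                      (w₁ w₂ : InfinitePlace L) (cL cL' : ℂ),
                      w₁ ≠ w₂ → (∀ w : InfinitePlace L, w = w₁ ∨ w = w₂) →
                      (∀ (χ : HeckeCharacter K) (n : ℕ), 0 < n → (∀ v : HeightOneSpectrum (𝓞 K), χ.IsUnramifiedAt v) →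
                        χ.HasInfinityType (fun _ ↦ (n : ℤ)) (fun _ ↦ -(n : ℤ)) →
                        KatzCM.HasKatzType ι' Sp (lam * χ.compRelNorm L) 1 (fun w ↦ if w = w₁ then n else n - 1)) →
                      (∀ (χ : HeckeCharacter K) (n : ℕ), 0 < n → (∀ v : HeightOneSpectrum (𝓞 K), χ.IsUnramifiedAt v) →
                        χ.HasInfinityType (fun _ ↦ (n : ℤ)) (fun _ ↦ -(n : ℤ)) →
                        LFunction.HasEntireContinuation (heckeLFunction (lam * χ.compRelNorm L))) →
                      cL ≠ 0 → cL' ≠ 0 →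
                      (∀ (χ : HeckeCharacter K) (n : ℕ), 0 < n → (∀ v : HeightOneSpectrum (𝓞 K), χ.IsUnramifiedAt v) →
                        χ.HasInfinityType (fun _ ↦ (n : ℤ)) (fun _ ↦ -(n : ℤ)) →
                        ∀ hL : LFunction.HasEntireContinuation (heckeLFunction (lam * χ.compRelNorm L)),
                          hL.continuation 0 = cL * cL' ^ n * rankinSelbergValueHecke f χ 1) →
                      (∀ w ∈ S ∪ KatzCM.primesOver L p, ¬ lam.IsUnramifiedAt w) →
                      (∀ w ∈ Sp ∪ T, ¬ lam.IsUnramifiedAt w) →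
                      CK ≠ 0 → (∀ w, Ω w ≠ 0) → (∀ w, (KatzCM.embeddingAt ι' Sp w ϑ).im ≠ 0) → (∀ w, ΩpK w ≠ 0) →
                      (∀ (χ : HeckeCharacter K) (n : ℕ), 0 < n → (∀ v : HeightOneSpectrum (𝓞 K), χ.IsUnramifiedAt v) →
                        χ.HasInfinityType (fun _ ↦ (n : ℤ)) (fun _ ↦ -(n : ℤ)) →
                        ∀ r : FramedGaloisRep K (PadicAlgCl p) 1, IsPAdicAvatarOf ι' χ r → FactorsThroughZp κ r →
                        ∀ hL : LFunction.HasEntireContinuation (heckeLFunction (lam * χ.compRelNorm L)),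
                          IntSeries.HasValueAt G (avatarValueAt r γ - 1)
                            ((((ι'.symm (KatzCM.interpolationValue ι' Sp S T lam (χ.compRelNorm L) 1
                                (fun w ↦ if w = w₁ then n else n - 1) ϑ CK Ω (hL.continuation 0))) : PadicAlgCl p) : ℂ_[p]) *
                              ∏ w, ΩpK w ^ (1 + 2 * (fun w ↦ if w = w₁ then n else n - 1) w))) →
                    ∀ (d₀ : ℤ) (r : AlgebraicClosure K) (ψ : (W.baseChange K).geomPoints →+ (W.baseChange K).geomPoints),
                      r * r = algebraMap K (AlgebraicClosure K) (d₀ : K) →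
                      r ∉ Set.range (algebraMap K (AlgebraicClosure K)) →
                      (∀ y : ZMod p, y * y ≠ PadicInt.toZMod ((d₀ : ℤ) : ℤ_[p])) →
                      (∀ σ : absoluteGaloisGroup K, σ • r = r → ∀ P : (W.baseChange K).geomPoints, σ • ψ P = ψ (σ • P)) →
                      (∀ σ : absoluteGaloisGroup K, σ • r = -r → ∀ P : (W.baseChange K).geomPoints, σ • ψ P = -ψ (σ • P)) →
                      (∀ P, ψ (ψ P) = d₀ • P) →
                    ∀ (U : Subgroup (absoluteGaloisGroup K)) [U.Normal], (∀ σ, σ ∈ U ↔ σ • r = r) →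
                    ∀ (φ : (W.baseChange K).geomPrimaryTorsion p →+ (W.baseChange K).geomPrimaryTorsion p)
                      (_ : ∀ m, ((φ m : (W.baseChange K).geomPrimaryTorsion p) : (W.baseChange K).geomPoints) = ψ m)
                      (hφH' : ∀ (x : (κ.kerSubgroup ⊓ U : Subgroup (absoluteGaloisGroup K)))
                        (m : (W.baseChange K).geomPrimaryTorsion p), φ (x • m) = x • φ m)
                      (hφU : ∀ σ ∈ U, ∀ m : (W.baseChange K).geomPrimaryTorsion p, φ (σ • m) = σ • φ m)
                      (hφU' : ∀ σ, σ ∉ U → ∀ m : (W.baseChange K).geomPrimaryTorsion p, φ (σ • m) = -(σ • φ m))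
                      (hφ2 : ∀ m, φ (φ m) = d₀ • m)
                      (γ' : absoluteGaloisGroup K) (_ : κ.IsTopGenerator γ') (_ : γ' ∈ U)
                      (f₁ : AddMonoid.End (selmerOver (κ.kerSubgroup ⊓ U) ((W.baseChange K).geomPrimaryTorsion p) p 𝔭' ∅))
                      (_hf : ∀ s, ((f₁ s : selmerOver (κ.kerSubgroup ⊓ U) ((W.baseChange K).geomPrimaryTorsion p) p 𝔭' ∅) :
                        subgroupH1 (κ.kerSubgroup ⊓ U) ((W.baseChange K).geomPrimaryTorsion p)) =
                          conjH1 (κ.kerSubgroup ⊓ U) ((W.baseChange K).geomPrimaryTorsion p) γ' s)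
                      (h : IsLocNil p (f₁ - 1))
                      (δ : LocNilDual (selmerOver (κ.kerSubgroup ⊓ U) ((W.baseChange K).geomPrimaryTorsion p) p 𝔭' ∅) f₁ h
                        →ₗ[IwasawaAlgebra p]
                        LocNilDual (selmerOver (κ.kerSubgroup ⊓ U) ((W.baseChange K).geomPrimaryTorsion p) p 𝔭' ∅) f₁ h)
                      (hδ : ∀ (x : LocNilDual (selmerOver (κ.kerSubgroup ⊓ U) ((W.baseChange K).geomPrimaryTorsion p) p 𝔭' ∅) f₁ h)
                        (s t : selmerOver (κ.kerSubgroup ⊓ U) ((W.baseChange K).geomPrimaryTorsion p) p 𝔭' ∅),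
                        (t : subgroupH1 (κ.kerSubgroup ⊓ U) ((W.baseChange K).geomPrimaryTorsion p)) =
                          resH1Hom (ContinuousMonoidHom.id _) φ hφH'
                            (s : subgroupH1 (κ.kerSubgroup ⊓ U) ((W.baseChange K).geomPrimaryTorsion p)) → δ x s = x t)
                      (b : Module.Basis (Fin 2) ℤ_[p]
                        (AdjoinRoot (Polynomial.X ^ 2 - Polynomial.C ((d₀ : ℤ) : ℤ_[p]) : Polynomial ℤ_[p]))) (hb0 : b 0 = 1)
                      (hb1 : b 1 * b 1 = algebraMap ℤ_[p]
                        (AdjoinRoot (Polynomial.X ^ 2 - Polynomial.C ((d₀ : ℤ) : ℤ_[p]) : Polynomial ℤ_[p])) ((d₀ : ℤ) : ℤ_[p]))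
                      (ι : AdjoinRoot (Polynomial.X ^ 2 - Polynomial.C ((d₀ : ℤ) : ℤ_[p]) : Polynomial ℤ_[p]) →+* 𝓞_ℂ_[p])
                      (_ : ι.comp (algebraMap ℤ_[p] _) = R1.toCpInt p),
                      ∃ m : ℕ, ∀ x ∈ (charIdeal (PowerSeries
                          (AdjoinRoot (Polynomial.X ^ 2 - Polynomial.C ((d₀ : ℤ) : ℤ_[p]) : Polynomial ℤ_[p])))
                          (WithQuadratic (LocNilDual (selmerOver (κ.kerSubgroup ⊓ U) ((W.baseChange K).geomPrimaryTorsion p)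
                            p 𝔭' ∅) f₁ h) b hb0 hb1 δ
                            (delta_sq (W.baseChange K) κ 𝔭' ∅ U φ hφH' hφU hφU' d₀ hφ2 f₁ h δ hδ))).map (PowerSeries.map ι),
                        (PowerSeries.C ((p : ℕ) : 𝓞_ℂ_[p]) : PowerSeries 𝓞_ℂ_[p]) ^ m * x ∈ Ideal.span {G}) :
  thmB_exists_isHsiehLFunction_coeff_norm_eq_one_unrPeriod_anyLevel →
  ∀ (W : WeierstrassCurve ℚ) [W.IsElliptic] [W.IsGloballyMinimal] (p : ℕ) [Fact p.Prime]
    [NeZero (W.conductorNorm ℤ)] (K : Type) [Field K] [NumberField K],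
    W.HasCM → W.analyticRank = 1 → p = 3 → CMInert W p → ¬ Good W p →
    IsImaginaryQuadratic K → SatisfiesHeegnerHypothesis (W.conductorNorm ℤ) K →
    4 < (NumberField.discr K).natAbs →
    ¬ p ∣ NumberField.classNumber K →
    (W.quadraticTwist (NumberField.discr K : ℚ)).entireLFunction 1 ≠ 0 →
    ∀ (κ : ZpExtension K p), κ.IsAnticyclotomic →
      ∀ (γ : Field.absoluteGaloisGroup K) [Fact (κ.IsTopGenerator γ)]
        (𝔭 : HeightOneSpectrum (𝓞 K)), ((p : ℕ) : 𝓞 K) ∈ 𝔭.asIdeal →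
        𝔭.asIdeal.ramificationIdx (𝓞 ℚ) = 1 → 𝔭.asIdeal.inertiaDeg (𝓞 ℚ) = 1 →
        ∀ (𝔭' : HeightOneSpectrum (𝓞 K)), ((p : ℕ) : 𝓞 K) ∈ 𝔭'.asIdeal → 𝔭' ≠ 𝔭 →
        Module.IsTorsion (IwasawaAlgebra p) (XAc (W.baseChange K) p κ 𝔭' ∅ γ) →
        ∀ (f : CuspForm (CongruenceSubgroup.Gamma0 (W.conductorNorm ℤ)) 2), IsNewformOf W f →
          ∀ (ι' : PadicAlgCl p ≃+* ℂ),
            (∀ (w : InfinitePlace K) (k : 𝓞 K), k ∈ 𝔭.asIdeal ↔ ‖ι'.symm (w.embedding (k : K))‖ < 1) →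
            ∀ (ΩK : ℂ) (Ωp : (unrIntegers p)ˣ) (Q : PowerSeries (PadicComplexInt p)), ΩK ≠ 0 →
              R1.IsBDPLFunctionInt p ι' 𝔭 κ γ f ΩK ((Ωp : unrIntegers p) : (PadicComplex p)) Q →
                (XAc.charIdeal (W.baseChange K) p κ 𝔭' ∅ γ).map
                    ((R1.toCpInt p).comp (PowerSeries.constantCoeff : IwasawaAlgebra p →+* ℤ_[p])) ≤
                  Ideal.span {PowerSeries.constantCoeff Q} :=
  Summit.BirchSwinnertonDyer.BirchSwinnertonDyer.Theorems.InertBadSignedBranchesInertBadAtThreeHeartOfHeartFlat.heartAtThree_of_heartFlatAtThree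
    (heartFlatAtThree_of_V4R hV4R3)

end Summit.BirchSwinnertonDyer.BirchSwinnertonDyer.Theorems.InertBadSignedBranchesInertBadAtThreeHeartOfV4R

end
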